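import Mathlib
import HarnessLib
import Summits.AtomisticToContinuum.HydrodynamicLimit.Theorems.OneFlightGossipEngineKineticCurrentsWindowLDUniformAssembly
import Summits.AtomisticToContinuum.HydrodynamicLimit.Theorems.OneFlightGossipEngineKineticCurrentsWindowLDUniformJensenTimeSum
import Summits.AtomisticToContinuum.HydrodynamicLimit.Theorems.OneFlightGossipEngineKineticCurrentsWindowLDUniformFibreExpMoment
import Summits.AtomisticToContinuum.HydrodynamicLimit.Theorems.OneFlightGossipEngineKineticCurrentsWindowLDUniformClassTruncation
import Summits.AtomisticToContinuum.HydrodynamicLimit.Theorems.OneFlightGossipEngineKineticCurrentsWindowLDUniformPathwiseWindow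

/-!
# Pointwise-in-the-profile assembly for line `Sketch` of the crux `KineticCurrentsWindowLDUniform`
# (stmt-AtomisticToContinuum-14662)

`stub_assembly_at` (registered helper stub): the fixed-profile core of the landed assembly
`KineticCurrentsWindowLDUniformSketch.stub_assembly`, with the LANDED statics S1 (Jensen in time), S2 (fibre
exponential moments), S3 (class truncation), S4 (pathwise window integrability) used as theorems. For ONE profile
`(a, θ₀, u₀)` and one reduced density `σ ≤ 1/2`, the window transfer S5 AT THIS PROFILE and the bounded-class
residual S6 AT THIS PROFILE give the crux's conclusion at this profile. The landed assembly quantifies S5 over all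
profiles; this pointwise form is what lets partial transfers (the landed isothermal transfer
`stub_windowTransfer_isothermal`: constant `u₀, θ₀`, arbitrary continuous activity `a`) close the crux on
the corresponding sub-family of local Gibbs data modulo S6 alone (`stub_isothermalClosure`, companion file).
The proof is the landed assembly's, verbatim after its `η₀`/guard preamble.
-/

noncomputable section

open MeasureTheory Set Filter
open scoped ENNReal Topology

namespace Summit.AtomisticToContinuum.HydrodynamicLimit.Theorems.KineticCurrentsWindowLDUniformSketch

open Literature.Analysis.FluidPDE (HardSphereFlow Config localMaxwellian)
open Literature.MathematicalPhysics.KineticTheory (T3 V3 hsDiameter localGibbsLaw localGibbsMeasure)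

/-- **Registered helper stub `stub_assembly_at` of line `Sketch` — the assembly at a fixed profile.**
For every continuous positive profile `(a, θ₀, u₀)` and `σ ≤ 1/2`: (S5 at this profile) → for every flow family:
(S6 at this profile and flow family) → the conclusion of `OneFlightGossipEngine.KineticCurrentsWindowLDUniform` at
this profile (statics S1–S4 are the landed theorems). [folklore] -/
theorem stub_assembly_at :
    ∀ (a θ₀ : T3 → ℝ) (u₀ : T3 → V3), Continuous a → Continuous θ₀ → Continuous u₀ →
      (∀ x, 0 < a x) → (∀ x, 0 < θ₀ x) → ∀ σ : ℝ, 0 < σ → σ ≤ 1 / 2 →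
      (∃ q : ℝ, 1 ≤ q ∧ ∀ τ : ℝ, 0 < τ → ∀ δ : ℝ, 0 < δ →
        ∀ Φ : (N : ℕ) →
          HardSphereFlow (Literature.Analysis.FluidPDE.Torus.geometry (Fin 3)) (hsDiameter σ N) (N + 1),
        ∃ N₀ : ℕ, ∀ N : ℕ, N₀ ≤ N → ∀ r ∈ Set.Icc (0 : ℝ) (τ * ((N : ℝ) + 1) ^ (-(1 / 3 : ℝ))),
        ∀ G : Config (N + 1) (Fin 3) T3 → ℝ≥0∞, Measurable G →
          ∫⁻ z, G ((Φ N).flow r z) ∂(localGibbsLaw σ a u₀ θ₀ N (Φ N)) ≤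
            ENNReal.ofReal (Real.exp (δ * ((N : ℝ) + 1))) *
              (∫⁻ z, G z ^ q ∂(localGibbsLaw σ a u₀ θ₀ N (Φ N))) ^ (1 / q)) →
      ∀ Φ : (N : ℕ) →
        HardSphereFlow (Literature.Analysis.FluidPDE.Torus.geometry (Fin 3)) (hsDiameter σ N) (N + 1),
      (∀ C : ℝ, 0 ≤ C → ∃ β₀ : ℝ, 0 < β₀ ∧
        ∀ (A : T3 → Fin 3 → Fin 3 → ℝ) (H : T3 × ℝ → ℝ) (b : T3 → V3) (G : T3 × ℝ → ℝ),
        Continuous A → Continuous H → Continuous b → Continuous G →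
        ∀ (F : T3 × V3 → ℝ), (∀ y, F y =
          H (y.1, ‖y.2 - u₀ y.1‖ ^ 2) *
              (∑ j : Fin 3, ∑ k : Fin 3, A y.1 j k * ((y.2 - u₀ y.1) j * (y.2 - u₀ y.1) k)) +
            (∑ j : Fin 3, b y.1 j * (y.2 - u₀ y.1) j) * G (y.1, ‖y.2 - u₀ y.1‖ ^ 2)) →
        (∃ B : ℝ, ∀ y, |F y| ≤ B) → (∀ y, |F y| ≤ C * (1 + ‖y.2‖ ^ 2)) →
        (∀ x, ∫ v, F (x, v) * localMaxwellian 1 (θ₀ x) (u₀ x) v = 0) →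
        (∀ x (j : Fin 3), ∫ v, F (x, v) * v j * localMaxwellian 1 (θ₀ x) (u₀ x) v = 0) →
        (∀ x, ∫ v, F (x, v) * ‖v‖ ^ 2 * localMaxwellian 1 (θ₀ x) (u₀ x) v = 0) →
        ∀ β : ℝ, |β| ≤ β₀ → ∀ ε : ℝ, 0 < ε → ∃ τ : ℝ, 0 < τ ∧ ∃ N₀ : ℕ, ∀ N : ℕ, N₀ ≤ N →
          ∫⁻ z, ENNReal.ofReal (Real.exp (β * ∑ i : Fin (N + 1),
            (τ * ((N : ℝ) + 1) ^ (-(1 / 3 : ℝ)))⁻¹ *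
              ∫ r in (0 : ℝ)..(τ * ((N : ℝ) + 1) ^ (-(1 / 3 : ℝ))), F (((Φ N).flow r z) i)))
            ∂(localGibbsLaw σ a u₀ θ₀ N (Φ N)) ≤ ENNReal.ofReal (Real.exp (ε * ((N : ℝ) + 1)))) →
      ∀ (A : T3 → Fin 3 → Fin 3 → ℝ) (b : T3 → V3) (G : T3 × ℝ → ℝ),
        Continuous A → Continuous b → Continuous G →
        ∀ (F : T3 × V3 → ℝ), (∀ y, F y =
          (∑ j : Fin 3, ∑ k : Fin 3, A y.1 j k * ((y.2 - u₀ y.1) j * (y.2 - u₀ y.1) k)) +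
            (∑ j : Fin 3, b y.1 j * (y.2 - u₀ y.1) j) * G (y.1, ‖y.2 - u₀ y.1‖ ^ 2)) →
        (∃ C : ℝ, ∀ y, |F y| ≤ C * (1 + ‖y.2‖ ^ 2)) →
        (∀ x, ∫ v, F (x, v) * localMaxwellian 1 (θ₀ x) (u₀ x) v = 0) →
        (∀ x (j : Fin 3), ∫ v, F (x, v) * v j * localMaxwellian 1 (θ₀ x) (u₀ x) v = 0) →
        (∀ x, ∫ v, F (x, v) * ‖v‖ ^ 2 * localMaxwellian 1 (θ₀ x) (u₀ x) v = 0) →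
        ∃ β₀ : ℝ, 0 < β₀ ∧ ∀ β : ℝ, |β| ≤ β₀ → ∀ ε : ℝ, 0 < ε → ∃ τ : ℝ, 0 < τ ∧ ∃ N₀ : ℕ, ∀ N : ℕ, N₀ ≤ N →
          ∫⁻ z, ENNReal.ofReal (Real.exp (β * ∑ i : Fin (N + 1),
            (τ * ((N : ℝ) + 1) ^ (-(1 / 3 : ℝ)))⁻¹ *
              ∫ r in (0 : ℝ)..(τ * ((N : ℝ) + 1) ^ (-(1 / 3 : ℝ))), F (((Φ N).flow r z) i)))
            ∂(localGibbsLaw σ a u₀ θ₀ N (Φ N)) ≤ ENNReal.ofReal (Real.exp (ε * ((N : ℝ) + 1))) := by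
  intro a θ₀ u₀ ha hθ hu ha0 hθ0 σ hσ hσ2 hWTat Φ hC6at A b G hA hb hG F hFdef hgrowth h1 hv h2
  have hJ := stub_jensenTimeSum
  have hFib := stub_fibreExpMoment
  have hTr := stub_classTruncation
  have hPW := stub_pathwiseWindow
  obtain ⟨C, hC⟩ := hgrowth
  have hFfun : F = fun y =>
      (∑ j : Fin 3, ∑ k : Fin 3, A y.1 j k * ((y.2 - u₀ y.1) j * (y.2 - u₀ y.1) k)) +
        (∑ j : Fin 3, b y.1 j * (y.2 - u₀ y.1) j) * G (y.1, ‖y.2 - u₀ y.1‖ ^ 2) := funext hFdef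
  have hFc : Continuous F := by
    rw [hFfun]
    fun_prop
  -- S3: the truncation constants `C₁, κ₀`
  obtain ⟨C₁, hC₁, κ₀, hκ₀, hTrunc⟩ :=
    hTr θ₀ u₀ hθ hu hθ0 A b G hA hb hG F hFdef C hC h1 hv h2
  -- S6: `β₁` for the growth constant `C₁`
  obtain ⟨β₁, hβ₁, hBdd⟩ := hC6at C₁ hC₁
  -- S5: the transfer exponent `q`
  obtain ⟨q, hq, hWT⟩ := hWTat
  have hq0 : 0 < q := one_pos.trans_le hq
  refine ⟨min (β₁ / 2) (κ₀ / (2 * q)), lt_min (by positivity) (by positivity), ?_⟩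
  intro β hβ ε hε
  have hβ1 : |β| ≤ β₁ / 2 := hβ.trans (min_le_left _ _)
  have hβ2 : |β| ≤ κ₀ / (2 * q) := hβ.trans (min_le_right _ _)
  have hqβ : q * (2 * |β|) ≤ κ₀ := by
    rw [le_div_iff₀ (by positivity)] at hβ2
    linarith
  -- truncation at tail level `η = ε/2`
  obtain ⟨H', G', hH', hG', F', Y, hF'def, hYc, hY0, hB, hF'gr, h1', hv', h2', hRY, hYexp⟩ :=
    hTrunc (ε / 2) (by positivity)
  have hF'c : Continuous F' := by
    rw [show F' = fun y => H' (y.1, ‖y.2 - u₀ y.1‖ ^ 2) *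
        (∑ j : Fin 3, ∑ k : Fin 3, A y.1 j k * ((y.2 - u₀ y.1) j * (y.2 - u₀ y.1) k)) +
        (∑ j : Fin 3, b y.1 j * (y.2 - u₀ y.1) j) * G' (y.1, ‖y.2 - u₀ y.1‖ ^ 2) from funext hF'def]
    fun_prop
  have hRc : Continuous fun y => F y - F' y := hFc.sub hF'c
  -- S6 on `F'` at `2β`, precision `ε`
  have h2β : |2 * β| ≤ β₁ := by rw [abs_mul, abs_two]; linarith
  obtain ⟨τ, hτ, N₁, hN₁⟩ :=
    hBdd A H' b G' hA hH' hb hG' F' hF'def hB hF'gr h1' hv' h2' (2 * β) h2β ε hε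
  -- S5 with this `τ` and `δ = ε/2`
  obtain ⟨N₂, hN₂⟩ := hWT τ hτ (ε / 2) (by positivity) Φ
  refine ⟨τ, hτ, max N₁ N₂, fun N hN => ?_⟩
  have hNN₁ : N₁ ≤ N := le_of_max_le_left hN
  have hNN₂ : N₂ ≤ N := le_of_max_le_right hN
  -- fixed `N`: window, law, good set
  set w : ℝ := τ * ((N : ℝ) + 1) ^ (-(1 / 3 : ℝ)) with hwdef
  have hw : 0 < w := by positivity
  set P := localGibbsLaw σ a u₀ θ₀ N (Φ N) with hPdef
  have hPac : P ≪ Literature.Analysis.FluidPDE.liouville (Literature.Analysis.FluidPDE.Torus.geometry (Fin 3))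
      (N + 1) (hsDiameter σ N) := by
    rw [hPdef, Literature.MathematicalPhysics.KineticTheory.localGibbsLaw,
      Literature.Analysis.FluidPDE.particleLaw_eq]
    exact withDensity_absolutelyContinuous _ _
  have hPgood : P (Φ N).goodᶜ = 0 := hPac (Φ N).measure_compl_good
  have hae : ∀ᵐ z ∂P, z ∈ (Φ N).good := mem_ae_iff.2 hPgood
  -- Step 1: pathwise splitting, a.e.
  have hsplit : ∀ᵐ z ∂P, β * ∑ i, w⁻¹ * ∫ r in (0 : ℝ)..w, F (((Φ N).flow r z) i) ≤
      (β * ∑ i, w⁻¹ * ∫ r in (0 : ℝ)..w, F' (((Φ N).flow r z) i)) +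
        |β| * ∑ i, w⁻¹ * ∫ r in (0 : ℝ)..w, Y (((Φ N).flow r z) i) := by
    filter_upwards [hae] with z hz
    rw [Finset.mul_sum, Finset.mul_sum, Finset.mul_sum, ← Finset.sum_add_distrib]
    refine Finset.sum_le_sum fun i _ => ?_
    exact window_term_split (γ := fun r => ((Φ N).flow r z) i) hw.le
      (hPW σ N (Φ N) z hz F' hF'c i 0 w) (hPW σ N (Φ N) z hz _ hRc i 0 w)
      (hPW σ N (Φ N) z hz Y hYc i 0 w) hRY β
  -- measurability of the two window sums
  have hmeasF' : AEMeasurable (fun z => β * ∑ i, w⁻¹ * ∫ r in (0 : ℝ)..w, F' (((Φ N).flow r z) i)) P := by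
    refine AEMeasurable.const_mul (Finset.aemeasurable_fun_sum _ fun i _ => ?_) _
    exact ((Φ N).aemeasurable_intervalIntegral_comp_flow_torus (f := fun z => F' (z i))
      (hF'c.measurable.comp (measurable_pi_apply i)) 0 w hPgood).const_mul _
  have hmeasY : AEMeasurable (fun z => |β| * ∑ i, w⁻¹ * ∫ r in (0 : ℝ)..w, Y (((Φ N).flow r z) i)) P := by
    refine AEMeasurable.const_mul (Finset.aemeasurable_fun_sum _ fun i _ => ?_) _
    exact ((Φ N).aemeasurable_intervalIntegral_comp_flow_torus (f := fun z => Y (z i))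
      (hYc.measurable.comp (measurable_pi_apply i)) 0 w hPgood).const_mul _
  -- Step 2: Hölder
  have hHolder := lintegral_exp_le_of_le_add P hsplit hmeasF' hmeasY
  -- Step 3: the first factor is the bounded-class residual at `2β`
  have hA1 : ∫⁻ z, ENNReal.ofReal (Real.exp (2 * (β * ∑ i, w⁻¹ * ∫ r in (0 : ℝ)..w,
      F' (((Φ N).flow r z) i)))) ∂P ≤ ENNReal.ofReal (Real.exp (ε * ((N : ℝ) + 1))) := by
    have h := hN₁ N hNN₁
    refine le_of_eq_of_le (lintegral_congr fun z => ?_) h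
    rw [← mul_assoc]
  -- Step 4: the second factor — Jensen in time, window transfer, fibre moments
  set X : ℝ≥0∞ := ENNReal.ofReal (Real.exp (ε * ((N : ℝ) + 1))) with hXdef
  have hhalf : ENNReal.ofReal (Real.exp (ε / 2 * ((N : ℝ) + 1))) *
      ENNReal.ofReal (Real.exp (ε / 2 * ((N : ℝ) + 1))) = X := by
    rw [hXdef, ← ENNReal.ofReal_mul (Real.exp_pos _).le, ← Real.exp_add]
    congr 2; ring
  have hA2 : ∫⁻ z, ENNReal.ofReal (Real.exp (2 * (|β| * ∑ i, w⁻¹ * ∫ r in (0 : ℝ)..w,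
      Y (((Φ N).flow r z) i)))) ∂P ≤ X := by
    -- rewrite the exponent as a window sum of the non-negative `2|β| Y`
    have hrw : ∀ z, 2 * (|β| * ∑ i, w⁻¹ * ∫ r in (0 : ℝ)..w, Y (((Φ N).flow r z) i)) =
        ∑ i, w⁻¹ * ∫ r in (0 : ℝ)..w, 2 * |β| * Y (((Φ N).flow r z) i) := by
      intro z
      rw [← mul_assoc, Finset.mul_sum]
      refine Finset.sum_congr rfl fun i _ => ?_
      rw [intervalIntegral.integral_const_mul]
      ring
    simp_rw [hrw]
    -- Jensen in time (S1)
    have hJ' := hJ (Config (N + 1) (Fin 3) T3) P (Φ N).good (Φ N).measurableSet_good hPgood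
      (Φ N).flow (Φ N).measurable_flow_prod_torus (N + 1) (fun i z => 2 * |β| * Y (z i))
      (fun i => (hYc.measurable.comp (measurable_pi_apply i)).const_mul _)
      (fun i z => mul_nonneg (mul_nonneg zero_le_two (abs_nonneg β)) (hY0 _)) w hw
    refine hJ'.trans (iSup₂_le fun r hr => ?_)
    -- window transfer (S5) at time `r`
    set Gf : Config (N + 1) (Fin 3) T3 → ℝ≥0∞ :=
      fun z => ENNReal.ofReal (Real.exp (∑ i, 2 * |β| * Y (z i))) with hGfdef
    have hGm : Measurable Gf := by
      refine (Real.measurable_exp.comp (Finset.measurable_sum _ fun i _ => ?_)).ennreal_ofReal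
      exact (hYc.measurable.comp (measurable_pi_apply i)).const_mul _
    have hT := hN₂ N hNN₂ r hr Gf hGm
    refine hT.trans ?_
    -- the `q`-th power is a product of one-body factors
    set g : T3 × V3 → ℝ≥0∞ := fun y => ENNReal.ofReal (Real.exp (q * (2 * |β| * Y y))) with hgdef
    have hgm : Measurable g :=
      (Real.measurable_exp.comp ((hYc.measurable.const_mul _).const_mul _)).ennreal_ofReal
    have hGq : ∀ z, Gf z ^ q = ∏ i, g (z i) := by
      intro z
      rw [hGfdef]
      simp only []
      rw [ENNReal.ofReal_rpow_of_nonneg (Real.exp_pos _).le hq0.le, ← Real.exp_mul, Finset.sum_mul,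
        Real.exp_sum, ENNReal.ofReal_prod_of_nonneg fun i _ => (Real.exp_pos _).le]
      refine Finset.prod_congr rfl fun i _ => ?_
      rw [hgdef]
      simp only []
      congr 2; ring
    simp_rw [hGq]
    -- fibre exponential moments (S2) fed by the truncation's tail clause
    set K : ℝ≥0∞ := ENNReal.ofReal (Real.exp (ε / 2)) with hKdef
    have hK1 : 1 ≤ K := by
      rw [hKdef, ← ENNReal.ofReal_one]
      exact ENNReal.ofReal_le_ofReal (Real.one_le_exp (by positivity))
    have hfib : ∫⁻ z, ∏ i, g (z i) ∂P ≤ K ^ (N + 1) := by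
      rw [hPdef, Literature.MathematicalPhysics.KineticTheory.localGibbsLaw_eq]
      refine hFib a θ₀ u₀ ha hθ hu ha0 hθ0 σ hσ hσ2 N g hgm K fun x => ?_
      refine le_trans (lintegral_mono fun v => ?_) (hYexp x)
      rw [hgdef]
      simp only []
      rw [← ENNReal.ofReal_mul (Real.exp_pos _).le]
      refine ENNReal.ofReal_le_ofReal (mul_le_mul_of_nonneg_right (Real.exp_le_exp.2 ?_)
        (Literature.MathematicalPhysics.KineticTheory.localMaxwellian_nonneg zero_le_one (hθ0 x).le _ _))
      rw [← mul_assoc]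
      exact mul_le_mul_of_nonneg_right hqβ (hY0 _)
    have hKpow : K ^ (N + 1) = ENNReal.ofReal (Real.exp (ε / 2 * ((N : ℝ) + 1))) := by
      rw [hKdef, ← ENNReal.ofReal_pow (Real.exp_pos _).le, ← Real.exp_nat_mul]
      congr 2; push_cast; ring
    have hroot : (∫⁻ z, ∏ i, g (z i) ∂P) ^ (1 / q) ≤ ENNReal.ofReal (Real.exp (ε / 2 * ((N : ℝ) + 1))) := by
      refine (ENNReal.rpow_le_rpow hfib (by positivity)).trans ?_
      rw [← hKpow]
      refine ennreal_rpow_le_self_of_one_le (one_le_pow_of_one_le' hK1 _) ?_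
      rw [div_le_one hq0]; exact hq
    rw [← hhalf]
    exact mul_le_mul' le_rfl hroot
  -- Step 5: combine
  calc ∫⁻ z, ENNReal.ofReal (Real.exp (β * ∑ i, w⁻¹ * ∫ r in (0 : ℝ)..w, F (((Φ N).flow r z) i))) ∂P
      ≤ _ := hHolder
    _ ≤ X ^ (1 / 2 : ℝ) * X ^ (1 / 2 : ℝ) :=
        mul_le_mul' (ENNReal.rpow_le_rpow hA1 (by norm_num)) (ENNReal.rpow_le_rpow hA2 (by norm_num))
    _ = X := by
        rw [← ENNReal.rpow_add _ _ (ENNReal.ofReal_pos.2 (Real.exp_pos _)).ne' ENNReal.ofReal_ne_top,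
          show (1 / 2 : ℝ) + 1 / 2 = 1 by norm_num, ENNReal.rpow_one]

end Summit.AtomisticToContinuum.HydrodynamicLimit.Theorems.KineticCurrentsWindowLDUniformSketch
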